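import Summits.BirchSwinnertonDyer.BirchSwinnertonDyer.Theorems.GoldfeldK12AdditiveTwoRamifiedHeegner
import Summits.BirchSwinnertonDyer.BirchSwinnertonDyer.Theorems.GoldfeldAllTwistsTwoConverseTwinAdditivePrimeTwistDescent
import Summits.BirchSwinnertonDyer.BirchSwinnertonDyer.Theorems.GoldfeldAllTwistsTwoConverseTwinAdditiveSign
import Literature.NumberTheory.EllipticCurves.TwoIsogenyShaTwoTorsion
import Literature.NumberTheory.EllipticCurves.SelmerCorankProofs
import HarnessLib

set_option linter.dupNamespace false -- namespace `…BirchSwinnertonDyer.BirchSwinnertonDyer…` is the cell's (D-0017 nested layout)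
set_option autoImplicit false

/-!
# Crux K12₂″ (item 20044) CONTAINS «Conjecture D»: every model of `49a1^{(−q)}` (`q ≡ 1 (mod 4)` prime,
# inert in `ℚ(√−7)`) has `corank_{ℤ₂} Sel_{2^∞} = 1`, so the crux — and already its Heegner sub-leaf over
# `ℚ(√−q)` — asserts `ord_{s=1} L(49a1^{(−q)}, s) = 1` for EVERY such `q`

Cell `bsd-goldfeld`, prover seat `bsd-goldfeld-s1p-c201` (gen 4), `--supports stmt-BirchSwinnertonDyer-20044`
(route decl `…Theses.GoldfeldAllTwistsTwoConverse.RankOneTwoConverseCMSevenAdditiveTwo`). A WITNESS-OF-STRENGTH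
file (nothing here proves the item; BSD is not proved by any of this): it makes kernel-precise the memo line
«K12₂″ restricted to 𝒟 ⟺ Conjecture D» (HOME `K12PP-RINGCLASS.md` §6, `K12PP-KRIZ-RAMIFIED.md` §2) on the prime
family `𝒟₁ = {49a1^{(−q)} : q prime, q ≡ 1 (mod 4), (−7/q) = −1}`, where seat c301's complete `2`-isogeny
descent (`…TwinAdditivePrimeTwistDescent`: `#S ≤ 4`, `#S' ≤ 2`, so `rank ≤ 1` and `rank = 1 ⇒ Ш[2] = 0`,
UNCONDITIONAL) had left «the root number / parity route to rank = 1 without `r_an = 1`» undone.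

* §1 (any number field, any `V` in two-torsion normal form, `φ : V → V'`): the COUNTING form of the tree's
  `Ш(V)[φ] = 0 ∧ Ш(V')[φ̂] = 0 ⇒ Ш(V')[2] = 0` — `#(Ш(V') ∩ H¹[2]) ≤ #(Ш(V) ∩ im Ξ_V) · #(Ш(V') ∩ im Ξ_{V'})` —
  and `#(Ш ∩ H¹[2]) ≤ 2 ⇒ corank_{ℤ₂} Ш[2^∞] ≤ 1` (the tree's corank formula is `dim Ш[2^∞][2] − dim Ш[2^∞]/2`).
* §2 on c301's two-torsion model `E_{−q} : y² = x³ − 21q x² + 112q² x`: the descent count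
  `2^{dim S + dim S'} = 2^{rank+2} · #Ш(V₀)[Ξ] · #Ш(E)[Ξ] ≤ 8` gives `#(Ш(E_{−q}) ∩ H¹[2]) ≤ 2`, hence
  `corank_{ℤ₂} Ш[2^∞] ≤ 1` and `corank_{ℤ₂} Sel_{2^∞}(E_{−q}) ≤ 1` — UNCONDITIONAL.
* §3 for EVERY model `W` (`C • W = cm7^{(−q)}`): `corank_{ℤ₂} Sel_{2^∞}(W/ℚ) = 1`, granted the `2`-parity theorem
  (`hpar`, Dokchitser–Dokchitser), Modularity (`hnf`) and CLTZ Thm. 1.2 at `R = 1` (`h12`; `w(W) = −1` by c301's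
  `…TwinAdditiveSign`). THE HYPOTHESIS OF K12₂″ HOLDS THROUGHOUT `𝒟₁`.
* §4 CONSEQUENCES: the crux K12₂″ (route decl, as hypothesis `hXL`) ⟹ `ord_{s=1} L(W, s) = 1` for every such
  `W` («Conjecture D(q)»: `L'(49a1^{(−q)}, 1) ≠ 0` for EVERY prime `q ≡ 1 (mod 4)` inert in `ℚ(√−7)`; with GZK
  also `rank = 1`, `Ш[2^∞] = 0`); the same from c201 file-1's `K`-level leaf, and from the Heegner sub-leaf
  `X049HeegnerNonTorsionEvenDiscr` at the single field `ℚ(√−q)` (`(q/7) = (−7/q)` for `q ≡ 1 (mod 4)`).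
  HONEST READING: any proof of item 20044 proves this infinite family of rank-one `L`-value statements, none in
  print (CLTZ Thm. 1.4, Shu–Zhai 2021 need an odd-class-number Heegner field; `h(−4q)` is even).

No `sorry`, no axiom, no definition, no instance, no notation. References: Silverman, *AEC* (2009) X.4.2(a),
X.4.9, III.6.1–6.2 [SilvermanAEC2009]; Greenberg, LNM 1716 (1999) §1 [Greenberg1999LNM]; T. & V. Dokchitser, Ann.
of Math. 172 (2010) Thm. 1.4 [DokchitserDokchitserAnnals2010]; Coates–Li–Tian–Zhai, PLMS 110 (2015) Thms. 1.2, 1.4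
[CoatesLiTianZhai2015]; Gross–Zagier, Invent. Math. 84 (1986) I.§7 [GrossZagier1986].
-/

noncomputable section
open scoped Classical
universe u

namespace Summit.BirchSwinnertonDyer.BirchSwinnertonDyer.Theorems.GoldfeldGoodTwists

open WeierstrassCurve Literature.NumberTheory Literature.NumberTheory.EllipticCurves
open _root_.WeierstrassCurve.Affine (SqUnits)

/-! ## §1 Counting `Ш[2]` through a `2`-isogeny, and the corank bound -/

section General

variable {K : Type u} [Field K] [NumberField K]

/-- **`#(Ш(V') ∩ H¹(K, V')[2]) ≤ #Ш(V)[φ] · #Ш(V')[φ̂]`** (`V` in two-torsion normal form over a number field,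
`φ : V → V'` the explicit `2`-isogeny, `ψ = φ̂`; `Ш(V)[φ] = Ш(V) ∩ im Ξ_V`, `Ш(V')[φ̂] = Ш(V') ∩ im Ξ_{V'}`, both
finite): `c ↦ ψ_* c` maps `Ш(V') ∩ H¹[2]` into `Ш(V) ∩ ker φ_*` with kernel inside `Ш(V') ∩ ker ψ_*`; count
`# = #image · #kernel` — the counting form of `eq_zero_of_mem_sha_twoIsogenyCodomain_of_two_smul_eq_zero`; the
source is finite too. [cite: SilvermanAEC2009, Thm. X.4.2(a) with Thm. III.6.1(a) and III.6.2(a)] -/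
theorem finite_and_natCard_sha_inf_torsionBy_two_le (V : WeierstrassCurve K) [V.IsTwoTorsionNF]
    [V.IsElliptic]
    [hAfin : Finite ↥(V.sha ⊓ AddMonoidHom.range (G := Additive (SqUnits K)) V.twoIsogenyTorsorHom)]
    [hBfin : Finite ↥(V.twoIsogenyCodomain.sha ⊓
      AddMonoidHom.range (G := Additive (SqUnits K)) V.twoIsogenyCodomain.twoIsogenyTorsorHom)] :
    Finite ↥(V.twoIsogenyCodomain.sha ⊓ AddSubgroup.torsionBy V.twoIsogenyCodomain.galH1 2) ∧
    Nat.card ↥(V.twoIsogenyCodomain.sha ⊓ AddSubgroup.torsionBy V.twoIsogenyCodomain.galH1 2) ≤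
      Nat.card ↥(V.sha ⊓ AddMonoidHom.range (G := Additive (SqUnits K)) V.twoIsogenyTorsorHom) *
      Nat.card ↥(V.twoIsogenyCodomain.sha ⊓
        AddMonoidHom.range (G := Additive (SqUnits K)) V.twoIsogenyCodomain.twoIsogenyTorsorHom) := by
  obtain ⟨ψ, hψφ, hφψ⟩ := V.exists_isogeny_comp_twoIsogeny_eq_two
  set S := V.twoIsogenyCodomain.sha ⊓ AddSubgroup.torsionBy V.twoIsogenyCodomain.galH1 2 with hS
  set A := V.sha ⊓ AddMonoidHom.range (G := Additive (SqUnits K)) V.twoIsogenyTorsorHom with hA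
  set B := V.twoIsogenyCodomain.sha ⊓
    AddMonoidHom.range (G := Additive (SqUnits K)) V.twoIsogenyCodomain.twoIsogenyTorsorHom with hB
  let g : ↥S →+ V.galH1 := (galH1Map ψ.toAddMonoidHom ψ.equivariant).comp S.subtype
  -- the image of `g` lies in `A = Ш(V) ∩ im Ξ_V`
  have hrange : g.range ≤ A := by
    rintro _ ⟨c, rfl⟩
    have hc : (c : V.twoIsogenyCodomain.galH1) ∈ V.twoIsogenyCodomain.sha := (AddSubgroup.mem_inf.mp c.2).1
    have h2 : 2 • (c : V.twoIsogenyCodomain.galH1) = 0 :=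
      (AddSubgroup.torsionBy.nsmul_iff (n := 2)).mp (AddSubgroup.mem_inf.mp c.2).2
    refine AddSubgroup.mem_inf.mpr ⟨?_, ?_⟩
    · exact galH1Map_mem_sha ψ.toAddMonoidHom ψ.equivariant ψ.hasLocalPointsMaps_toAddMonoidHom hc
    · rw [range_twoIsogenyTorsorHom_eq_ker_galH1Map, AddMonoidHom.mem_ker]
      show galH1Map V.twoIsogenyGeomHom (twoIsogenyGeomHom_smul V)
        (galH1Map ψ.toAddMonoidHom ψ.equivariant c) = 0
      rw [galH1Map_galH1Map_of_comp_eq_nsmul ψ.toAddMonoidHom ψ.equivariant V.twoIsogenyGeomHom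
        (twoIsogenyGeomHom_smul V) hφψ c, h2]
  -- the kernel of `g` lies in `B = Ш(V') ∩ im Ξ_{V'}`
  have hker : g.ker.map S.subtype ≤ B := by
    rintro _ ⟨c, hc0, rfl⟩
    have hc : (c : V.twoIsogenyCodomain.galH1) ∈ V.twoIsogenyCodomain.sha := (AddSubgroup.mem_inf.mp c.2).1
    refine AddSubgroup.mem_inf.mpr ⟨hc, ?_⟩
    rw [range_twoIsogenyTorsorHom_eq_ker_galH1Map,
      ← ker_galH1Map_eq_of_comp_twoIsogeny ψ.toAddMonoidHom ψ.equivariant (fun P ↦ ?_),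
      AddMonoidHom.mem_ker]
    · exact (AddMonoidHom.mem_ker).mp hc0
    · rw [hψφ, ← natCast_zsmul]
  -- counting: `#S = #(S/ker g) · #ker g = #range g · #ker g ≤ #A · #B`
  have h1 : Nat.card ↥S = Nat.card (↥S ⧸ g.ker) * Nat.card g.ker := g.ker.card_eq_card_quotient_mul_card_addSubgroup
  have h2 : Nat.card (↥S ⧸ g.ker) = Nat.card g.range := Nat.card_congr (QuotientAddGroup.quotientKerEquivRange g).toEquiv
  have h3 : Nat.card g.range ≤ Nat.card ↥A := AddSubgroup.card_le_of_le hrange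
  have h4 : Nat.card g.ker ≤ Nat.card ↥B := by
    rw [← AddSubgroup.card_map_of_injective (K := g.ker) (AddSubgroup.subtype_injective S)]
    exact AddSubgroup.card_le_of_le hker
  -- finiteness: range and kernel are finite (inside `A`, resp. mapped injectively into `B`) and nonempty
  haveI : Finite ↥g.range := Finite.of_injective _ (AddSubgroup.inclusion_injective hrange)
  haveI : Finite ↥(g.ker.map S.subtype) := Finite.of_injective _ (AddSubgroup.inclusion_injective hker)
  haveI : Finite ↥g.ker :=
    Finite.of_equiv _ (g.ker.equivMapOfInjective S.subtype (AddSubgroup.subtype_injective S)).toEquiv.symm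
  rw [h1, h2]
  exact ⟨Nat.finite_of_card_ne_zero (by rw [h1, h2]; exact Nat.mul_ne_zero Nat.card_pos.ne' Nat.card_pos.ne'),
    Nat.mul_le_mul h3 h4⟩

/-- The same bound with the `2`-isogenous curve named (`V' = V.twoIsogenyCodomain`, as for the tree's half-models,
`twoIsogenyCodomain_halfModel`). [cite: SilvermanAEC2009, Thm. X.4.2(a)] -/
theorem finite_and_natCard_sha_inf_torsionBy_two_le_of_eq (V : WeierstrassCurve K) [V.IsTwoTorsionNF]
    [V.IsElliptic] (V' : WeierstrassCurve K) [V'.IsTwoTorsionNF] [V'.IsElliptic] (hV' : V.twoIsogenyCodomain = V')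
    (hA : Finite ↥(V.sha ⊓ AddMonoidHom.range (G := Additive (SqUnits K)) V.twoIsogenyTorsorHom))
    (hB : Finite ↥(V'.sha ⊓ AddMonoidHom.range (G := Additive (SqUnits K)) V'.twoIsogenyTorsorHom)) :
    Finite ↥(V'.sha ⊓ AddSubgroup.torsionBy V'.galH1 2) ∧
    Nat.card ↥(V'.sha ⊓ AddSubgroup.torsionBy V'.galH1 2) ≤
      Nat.card ↥(V.sha ⊓ AddMonoidHom.range (G := Additive (SqUnits K)) V.twoIsogenyTorsorHom) *
      Nat.card ↥(V'.sha ⊓ AddMonoidHom.range (G := Additive (SqUnits K)) V'.twoIsogenyTorsorHom) := by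
  subst hV'
  haveI := hA
  haveI := hB
  exact finite_and_natCard_sha_inf_torsionBy_two_le V

/-- **`#(Ш(W) ∩ H¹[2]) ≤ 2 ⇒ corank_{ℤ₂} Ш(W/K)[2^∞] ≤ 1`**: the `2`-torsion of `Ш[2^∞]` injects into
`Ш ∩ H¹[2]`, an `𝔽₂`-space of dimension `≤ 1`, and the tree's corank formula `dim Ш[2^∞][2] − dim Ш[2^∞]/2`
(`zpCorank`) is at most that dimension. [cite: Greenberg1999LNM, §1 pp. 54–57] -/
theorem shaCorank_two_le_one_of_natCard_le_two (W : WeierstrassCurve K)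
    (hfin : Finite ↥(W.sha ⊓ AddSubgroup.torsionBy W.galH1 2))
    (h2 : Nat.card ↥(W.sha ⊓ AddSubgroup.torsionBy W.galH1 2) ≤ 2) : W.shaCorank 2 ≤ 1 := by
  haveI : Fact (Nat.Prime 2) := ⟨Nat.prime_two⟩
  haveI := hfin; set P := AddCommGroup.primaryComponent (↥W.sha) 2 with hP
  letI : Module (ZMod 2) ↥(AddSubgroup.torsionBy (↥P) ((2 : ℕ) : ℤ)) := AddSubgroup.torsionBy.zmodModule
  -- the `2`-torsion of `Ш[2^∞]` injects into `Ш ∩ H¹[2]`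
  let ι : ↥(AddSubgroup.torsionBy (↥P) ((2 : ℕ) : ℤ)) → ↥(W.sha ⊓ AddSubgroup.torsionBy W.galH1 2) :=
    fun t => ⟨((t : ↥P) : ↥W.sha), by
      refine AddSubgroup.mem_inf.mpr ⟨((t : ↥P) : ↥W.sha).2, ?_⟩
      have ht : ((2 : ℕ) : ℤ) • (t : ↥P) = 0 := by
        have h := t.2
        simp only [AddSubgroup.torsionBy, Submodule.mem_toAddSubgroup, Submodule.mem_torsionBy_iff] at h
        exact h
      have ht' : ((2 : ℕ) : ℤ) • ((((t : ↥P) : ↥W.sha)) : W.galH1) = 0 := by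
        rw [← AddSubgroupClass.coe_zsmul, ← AddSubgroupClass.coe_zsmul, ht, ZeroMemClass.coe_zero,
          ZeroMemClass.coe_zero]
      simp only [AddSubgroup.torsionBy, Submodule.mem_toAddSubgroup, Submodule.mem_torsionBy_iff]
      exact ht'⟩
  have hι : Function.Injective ι := by
    intro s t hst
    have h := congrArg (fun x : ↥(W.sha ⊓ AddSubgroup.torsionBy W.galH1 2) => (x : W.galH1)) hst
    exact Subtype.ext (Subtype.ext (Subtype.ext h))
  haveI : Finite ↥(AddSubgroup.torsionBy (↥P) ((2 : ℕ) : ℤ)) := Finite.of_injective ι hι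
  have hcard : Nat.card ↥(AddSubgroup.torsionBy (↥P) ((2 : ℕ) : ℤ)) ≤ 2 := (Nat.card_le_card_of_injective ι hι).trans h2
  have hpow := pow_finrank_eq_natCard (p := 2) ↥(AddSubgroup.torsionBy (↥P) ((2 : ℕ) : ℤ))
  have hfr : Module.finrank (ZMod 2) ↥(AddSubgroup.torsionBy (↥P) ((2 : ℕ) : ℤ)) ≤ 1 := by
    have h : 2 ^ Module.finrank (ZMod 2) ↥(AddSubgroup.torsionBy (↥P) ((2 : ℕ) : ℤ)) ≤ 2 ^ 1 := by
      rw [hpow, pow_one]; exact hcard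
    exact (Nat.pow_le_pow_iff_right (by norm_num)).mp h
  unfold WeierstrassCurve.shaCorank zpCorank
  exact (Nat.sub_le _ _).trans hfr

end General

/-! ## §2 The two-torsion model `E_{−q} : y² = x³ − 21q x² + 112q² x` of `49a1^{(−q)}` -/

/-- **`#(Ш(E_{−q}) ∩ H¹[2]) ≤ 2`, UNCONDITIONAL** (`q ≡ 1 (mod 4)` prime, `(−7/q) = −1`): c301's bounds
`#S ≤ 4`, `#S' ≤ 2` in `2^{dim S + dim S'} = 2^{rank + 2} · #Ш(V₀)[Ξ] · #Ш(E)[Ξ]` give `#Ш(V₀)[Ξ] · #Ш(E)[Ξ] ≤ 2`,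
and §1 bounds `#(Ш(E) ∩ H¹[2])` by that product. [cite: SilvermanAEC2009, Thm. X.4.2(a) and Prop. X.4.9] -/
theorem natCard_sha_inf_torsionBy_two_le_two_twoTorsionModel_primeTwist {l : ℕ} [Fact l.Prime]
    (hl4 : l % 4 = 1) (hl7 : legendreSym l (-7) = -1)
    [hE : (⟨0, ((-21 * l : ℤ) : ℚ), 0, ((112 * l ^ 2 : ℤ) : ℚ), 0⟩ : WeierstrassCurve ℚ).IsElliptic] :
    Finite ↥((⟨0, ((-21 * l : ℤ) : ℚ), 0, ((112 * l ^ 2 : ℤ) : ℚ), 0⟩ : WeierstrassCurve ℚ).sha ⊓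
        AddSubgroup.torsionBy (⟨0, ((-21 * l : ℤ) : ℚ), 0, ((112 * l ^ 2 : ℤ) : ℚ), 0⟩ : WeierstrassCurve ℚ).galH1 2) ∧
      Nat.card ↥((⟨0, ((-21 * l : ℤ) : ℚ), 0, ((112 * l ^ 2 : ℤ) : ℚ), 0⟩ : WeierstrassCurve ℚ).sha ⊓
        AddSubgroup.torsionBy (⟨0, ((-21 * l : ℤ) : ℚ), 0, ((112 * l ^ 2 : ℤ) : ℚ), 0⟩ : WeierstrassCurve ℚ).galH1 2)
        ≤ 2 := by
  have hab := hab_primeTwist (Fact.out : l.Prime)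
  haveI hV₀ := isElliptic_halfModel hab
  have hS : (twoIsogenySelmerGroup (-21 * l) (112 * l ^ 2)).card ≤ 4 := le_trans (Finset.card_le_card
    fun d hd => mem_of_mem_twoIsogenySelmerGroup_primeTwist hl7 hd) Finset.card_le_four
  have hS' : (twoIsogenySelmerGroup' (-21 * l) (112 * l ^ 2)).card ≤ 2 := le_trans (Finset.card_le_card
    fun d hd => mem_of_mem_twoIsogenySelmerGroup'_primeTwist hl4 hl7 hd) Finset.card_le_two
  have key := two_pow_twoIsogenySelmerRank_add_eq hab (hV₀ := hV₀) (hE := hE)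
  rw [← two_pow_twoIsogenySelmerRank_eq_card hab] at hS
  rw [← two_pow_twoIsogenySelmerRank'_eq_card hab] at hS'
  have h8 : 2 ^ (twoIsogenySelmerRank (-21 * (l : ℤ)) (112 * (l : ℤ) ^ 2) +
      twoIsogenySelmerRank' (-21 * (l : ℤ)) (112 * (l : ℤ) ^ 2)) ≤ 8 := by
    rw [pow_add]; exact Nat.mul_le_mul hS hS'
  rw [key] at h8
  -- abbreviate the two curves and the two `Ш`-parts
  set E : WeierstrassCurve ℚ := ⟨0, ((-21 * l : ℤ) : ℚ), 0, ((112 * l ^ 2 : ℤ) : ℚ), 0⟩ with hEdef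
  set V₀ : WeierstrassCurve ℚ :=
    ⟨0, -((-21 * l : ℤ) : ℚ) / 2, 0, (((-21 * l : ℤ) : ℚ) ^ 2 - 4 * ((112 * l ^ 2 : ℤ) : ℚ)) / 16, 0⟩ with hV₀def
  set n₁ := Nat.card ↥(V₀.sha ⊓ V₀.twoIsogenyTorsorHom.range) with hn₁
  set n₂ := Nat.card ↥(E.sha ⊓ E.twoIsogenyTorsorHom.range) with hn₂
  have h4 : 4 ≤ 2 ^ (E.mordellWeilRank + 2) := by
    calc (4 : ℕ) = 2 ^ 2 := by norm_num
      _ ≤ _ := Nat.pow_le_pow_right (by norm_num) (by omega)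
  have hprod : n₁ * n₂ ≤ 2 := by
    have : 4 * (n₁ * n₂) ≤ 8 := le_trans (Nat.mul_le_mul_right _ h4) h8
    omega
  have hpos : 0 < n₁ * n₂ := by
    refine Nat.pos_of_ne_zero fun h0 => ?_
    have : 0 < 2 ^ (twoIsogenySelmerRank (-21 * (l : ℤ)) (112 * (l : ℤ) ^ 2) +
        twoIsogenySelmerRank' (-21 * (l : ℤ)) (112 * (l : ℤ) ^ 2)) := by positivity
    rw [key, h0, mul_zero] at this
    exact lt_irrefl 0 this
  have hn₁0 : n₁ ≠ 0 := fun h => by rw [h, zero_mul] at hpos; exact lt_irrefl 0 hpos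
  have hn₂0 : n₂ ≠ 0 := fun h => by rw [h, mul_zero] at hpos; exact lt_irrefl 0 hpos
  have hA : Finite ↥(V₀.sha ⊓ V₀.twoIsogenyTorsorHom.range) := Nat.finite_of_card_ne_zero hn₁0
  have hB : Finite ↥(E.sha ⊓ E.twoIsogenyTorsorHom.range) := Nat.finite_of_card_ne_zero hn₂0
  obtain ⟨hfin, hle⟩ := finite_and_natCard_sha_inf_torsionBy_two_le_of_eq _ _
    (twoIsogenyCodomain_halfModel (-21 * (l : ℤ)) (112 * (l : ℤ) ^ 2)) hA hB
  exact ⟨hfin, le_trans hle hprod⟩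

/-- **`corank_{ℤ₂} Sel_{2^∞}(E_{−q}/ℚ) ≤ 1`, UNCONDITIONAL**: `s₂ = r + t₂` (Greenberg) with c301's `r ≤ 1`,
`r = 1 ⇒ Ш[2] = 0 ⇒ t₂ = 0`, and §2's `t₂ ≤ 1`. [cite: Greenberg1999LNM, §1 pp. 54–57] -/
theorem selmerCorank_two_le_one_twoTorsionModel_primeTwist {l : ℕ} [Fact l.Prime] (hl4 : l % 4 = 1)
    (hl7 : legendreSym l (-7) = -1)
    [hE : (⟨0, ((-21 * l : ℤ) : ℚ), 0, ((112 * l ^ 2 : ℤ) : ℚ), 0⟩ : WeierstrassCurve ℚ).IsElliptic] :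
    (⟨0, ((-21 * l : ℤ) : ℚ), 0, ((112 * l ^ 2 : ℤ) : ℚ), 0⟩ : WeierstrassCurve ℚ).selmerCorank 2 ≤ 1 := by
  haveI : Fact (Nat.Prime 2) := ⟨Nat.prime_two⟩
  set E : WeierstrassCurve ℚ := ⟨0, ((-21 * l : ℤ) : ℚ), 0, ((112 * l ^ 2 : ℤ) : ℚ), 0⟩ with hEdef
  obtain ⟨hfin, hcard⟩ := natCard_sha_inf_torsionBy_two_le_two_twoTorsionModel_primeTwist hl4 hl7 (hE := hE)
  have hsha : E.shaCorank 2 ≤ 1 := shaCorank_two_le_one_of_natCard_le_two E hfin hcard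
  obtain ⟨hr, hparts⟩ := rank_le_one_and_sha_two_twoTorsionModel_primeTwist hl4 hl7 (hE := hE)
  rw [E.selmerCorank_eq_mordellWeilRank_add_holds 2]
  rcases Nat.le_one_iff_eq_zero_or_eq_one.mp hr with h0 | h1
  · rw [h0, zero_add]; exact hsha
  · rw [h1, E.shaCorank_eq_zero_of_forall 2 (hparts h1)]

/-! ## §3 Every model of `49a1^{(−q)}` has `2^∞`-Selmer corank exactly `1` -/

/-- **`corank_{ℤ₂} Sel_{2^∞}(W/ℚ) ≤ 1`, UNCONDITIONAL, for every model `W` of `49a1^{(−q)}`** (`W ≅ E_{−q}` by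
c301's `smul_eq_twoTorsionModel_primeTwist`; the corank is an isomorphism invariant). [cite: Greenberg1999LNM, §1] -/
theorem selmerCorank_two_le_one_inertPrimeTwist {l : ℕ} [Fact l.Prime] (hl4 : l % 4 = 1)
    (hl7 : legendreSym l (-7) = -1) (W : WeierstrassCurve ℚ) [W.IsElliptic] (C : VariableChange ℚ)
    (hC : C • W = cm7.quadraticTwist ((-l : ℤ) : ℚ)) : W.selmerCorank 2 ≤ 1 := by
  have hl : l.Prime := Fact.out
  haveI := isElliptic_mk_of_ne_zero (F := ℚ) (hab_primeTwist hl)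
  rw [selmerCorank_eq_of_variableChange 2 (smul_eq_twoTorsionModel_primeTwist W C hC)]
  exact selmerCorank_two_le_one_twoTorsionModel_primeTwist hl4 hl7

/-- **THE HYPOTHESIS OF K12₂″ HOLDS ON THE WHOLE FAMILY: `corank_{ℤ₂} Sel_{2^∞}(W/ℚ) = 1` for every model `W`
of `49a1^{(−q)}`** (`q ≡ 1 (mod 4)` prime, `(−7/q) = −1`), granted `2`-parity (`hpar`), Modularity (`hnf`) and CLTZ
Thm. 1.2 at `R = 1` (`h12`): `≤ 1` unconditionally, odd since `w(W) = sign(−q) = −1` (c301).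
[cite: DokchitserDokchitserAnnals2010, Thm. 1.4] [cite: CoatesLiTianZhai2015, Thm. 1.2 (p. 359, case r = 0)] -/
theorem selmerCorank_two_eq_one_inertPrimeTwist
    (hpar : ∀ (W : WeierstrassCurve ℚ) [W.IsElliptic], p_parity W 2)
    (hnf : ModularForms.exists_isNewformOf) (h12 : CoatesLiTianZhai2015.thm12_fullBSD_twist)
    {l : ℕ} [Fact l.Prime] (hl4 : l % 4 = 1) (hl7 : legendreSym l (-7) = -1)
    (W : WeierstrassCurve ℚ) [W.IsElliptic] (C : VariableChange ℚ)
    (hC : C • W = cm7.quadraticTwist ((-l : ℤ) : ℚ)) : W.selmerCorank 2 = 1 := by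
  have hl : l.Prime := Fact.out
  have hle := selmerCorank_two_le_one_inertPrimeTwist hl4 hl7 W C hC
  have hsq : Squarefree (-(l : ℤ)) := by
    rw [← Int.squarefree_natAbs, Int.natAbs_neg, Int.natAbs_natCast]; exact hl.squarefree
  have h7 : ¬ (7 : ℤ) ∣ -(l : ℤ) := fun h => by
    have h7l : (7 : ℕ) ∣ l := by exact_mod_cast (Int.dvd_neg).mp h
    have := (Nat.prime_dvd_prime_iff_eq (by norm_num) hl).mp h7l
    omega
  have hw : W.rootNumber = -1 := by
    rw [rootNumber_of_smul_eq_quadraticTwist_cm7 hnf h12 hsq h7 W C (by exact_mod_cast hC)]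
    exact Int.sign_eq_neg_one_of_neg (by have := hl.pos; omega)
  have hp := hpar W
  rw [p_parity, hw] at hp
  rcases Nat.le_one_iff_eq_zero_or_eq_one.mp hle with h0 | h1
  · rw [h0, pow_zero] at hp; norm_num at hp
  exact h1

/-! ## §4 Conjecture D(q) from the crux, from the `K`-level leaf, and from the Heegner sub-leaf -/

/-- **Pointwise form of c201 file-1's leaf** (no condition at `7`): for `W ≅ E₀^{(n)}`, `n < 0` squarefree,
`n ≢ 1 (mod 4)`, `X049KLevelTwoConverseEvenDiscr` at `K = ℚ(√n)` gives `corank_{ℤ₂} Sel_{2^∞}(W) = 1 ⟹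
ord_{s=1} L(W, s) = 1`. [cite: CoatesLiTianZhai2015, Thm. 1.2 (p. 359, case r = 0)] [cite: GrossZagier1986, I.§7] -/
theorem analyticRank_eq_one_of_kLevelEvenDiscr (hmod : hasEntireLFunction_rat)
    (h12 : CoatesLiTianZhai2015.thm12_fullBSD_twist) (hX : X049KLevelTwoConverseEvenDiscr)
    (W : WeierstrassCurve ℚ) [W.IsElliptic] {n : ℤ} (hsq : Squarefree n) (hneg : n < 0) (hn4 : n % 4 ≠ 1)
    {C : VariableChange ℚ} (hC : C • W = cm7.quadraticTwist (n : ℚ)) (hsel : W.selmerCorank 2 = 1) :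
    W.analyticRank = 1 := by
  have hn0 : n ≠ 0 := hsq.ne_zero
  have hnQ : (n : ℚ) ≠ 0 := Int.cast_ne_zero.mpr hn0
  haveI := cm7.isElliptic_quadraticTwist hnQ
  have hnsq4 : ¬ (4 : ℤ) ∣ n := fun h4' ↦ by
    have h22 : (2 : ℤ) * 2 ∣ n := by rwa [show (2 : ℤ) * 2 = 4 by norm_num]
    have hu := Int.isUnit_iff.mp (hsq 2 h22)
    omega
  have hres : n % 4 = 2 ∨ n % 4 = 3 := by omega
  obtain ⟨K, _, _, h2, hdK⟩ := QuadraticFields.Quadratic.exists_numberField_discr_eq (D := 4 * n)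
    (Or.inr ⟨dvd_mul_right 4 n, by rw [show 4 * n / 4 = n by omega]; exact hres,
      by rw [show 4 * n / 4 = n by omega]; exact hsq⟩)
  have hK : IsImaginaryQuadratic K :=
    isImaginaryQuadratic_iff_discr_neg.mpr ⟨h2, by rw [hdK]; omega⟩
  have h4K : (4 : ℤ) ∣ NumberField.discr K := hdK ▸ dvd_mul_right 4 n
  have htw : cm7.quadraticTwist (NumberField.discr K : ℚ) =
      (⟨(Units.mk0 (2 : ℚ) two_ne_zero)⁻¹, 0, 0, 0⟩ : VariableChange ℚ) • cm7.quadraticTwist (n : ℚ) := by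
    rw [hdK]; exact quadraticTwist_cm7_four_mul n
  haveI : (cm7.quadraticTwist (NumberField.discr K : ℚ)).IsElliptic := by rw [htw]; infer_instance
  have hWdK : IsIsogenous W (cm7.quadraticTwist (NumberField.discr K : ℚ)) := by
    rw [htw]
    exact (isIsogenous_of_smul_eq hC).trans' (isIsogenous_smul _ _)
  have hselK : (cm7.baseChange K).selmerCorank 2 = 1 := by
    rw [selmerCorank_cm7_baseChange h12 K h2, ← hWdK.selmerCorank_eq 2, hsel]
  have hEK := hX K hK h4K hselK
  rw [analyticRankEK_cm7 hmod h12 K, ← analyticRank_eq_of_isIsogenous' hWdK] at hEK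
  exact hEK

/-- **c201 file-1's `K`-level leaf (at the one field `ℚ(√−q)`, `d_K = −4q`) ⟹ Conjecture D(q).**
[cite: CoatesLiTianZhai2015, Thm. 1.2 (p. 359, case r = 0)] [cite: DokchitserDokchitserAnnals2010, Thm. 1.4] -/
theorem analyticRank_eq_one_inertPrimeTwist_of_kLevelEvenDiscr
    (hpar : ∀ (W : WeierstrassCurve ℚ) [W.IsElliptic], p_parity W 2)
    (hnf : ModularForms.exists_isNewformOf) (h12 : CoatesLiTianZhai2015.thm12_fullBSD_twist)
    (hX : X049KLevelTwoConverseEvenDiscr)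
    {l : ℕ} [Fact l.Prime] (hl4 : l % 4 = 1) (hl7 : legendreSym l (-7) = -1)
    (W : WeierstrassCurve ℚ) [W.IsElliptic] (C : VariableChange ℚ)
    (hC : C • W = cm7.quadraticTwist ((-l : ℤ) : ℚ)) : W.analyticRank = 1 := by
  have hl : l.Prime := Fact.out
  have hsq : Squarefree (-(l : ℤ)) := by
    rw [← Int.squarefree_natAbs, Int.natAbs_neg, Int.natAbs_natCast]; exact hl.squarefree
  exact analyticRank_eq_one_of_kLevelEvenDiscr (hasEntireLFunction_rat_of_exists_isNewformOf hnf) h12 hX W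
    hsq (by have := hl.pos; omega) (by omega) (by exact_mod_cast hC)
    (selmerCorank_two_eq_one_inertPrimeTwist hpar hnf h12 hl4 hl7 W C hC)

/-- **K12₂″ ⟹ CONJECTURE D(q).** Granted `2`-parity (`hpar`), Modularity (`hnf`), CLTZ Thm. 1.2 at `R = 1` (`h12`)
and the crux K12₂″ (`hXL`, the route decl, as a HYPOTHESIS): for every prime `q ≡ 1 (mod 4)` with `(−7/q) = −1`
and every `W ≅ 49a1^{(−q)}`, `ord_{s=1} L(W, s) = 1` (`L'(49a1^{(−q)}, 1) ≠ 0`) — an infinite family of rank-one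
`L`-value statements on the additive cell, not in print (CLTZ Thm. 1.4 / Shu–Zhai need odd class number).
[cite: CoatesLiTianZhai2015, Thm. 1.2 and Thm. 1.4 (p. 359–360)] [cite: DokchitserDokchitserAnnals2010, Thm. 1.4] -/
theorem analyticRank_eq_one_inertPrimeTwist_of_crux
    (hpar : ∀ (W : WeierstrassCurve ℚ) [W.IsElliptic], p_parity W 2)
    (hnf : ModularForms.exists_isNewformOf) (h12 : CoatesLiTianZhai2015.thm12_fullBSD_twist)
    (hXL : Summit.BirchSwinnertonDyer.BirchSwinnertonDyer.Theses.GoldfeldAllTwistsTwoConverse.RankOneTwoConverseCMSevenAdditiveTwo)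
    {l : ℕ} [Fact l.Prime] (hl4 : l % 4 = 1) (hl7 : legendreSym l (-7) = -1)
    (W : WeierstrassCurve ℚ) [W.IsElliptic] (C : VariableChange ℚ)
    (hC : C • W = cm7.quadraticTwist ((-l : ℤ) : ℚ)) : W.analyticRank = 1 :=
  analyticRank_eq_one_inertPrimeTwist_of_kLevelEvenDiscr hpar hnf h12
    (kLevelEvenDiscr_of_rankOneTwoConverseCMSevenAdditiveTwo (hasEntireLFunction_rat_of_exists_isNewformOf hnf)
      h12 hXL) hl4 hl7 W C hC

/-- **K12₂″ ⟹ `rank W(ℚ) = 1` and `Ш(W/ℚ)[2^∞] = 0` on the whole family**, granted moreover GZK (`hGZK`)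
(c301's `bsdp_two_iff_shaAn_unit_primeTwist` fed with `r_an = 1`). [cite: SilvermanAEC2009, Thm. X.4.2(a)] -/
theorem rank_eq_one_inertPrimeTwist_of_crux
    (hpar : ∀ (W : WeierstrassCurve ℚ) [W.IsElliptic], p_parity W 2)
    (hnf : ModularForms.exists_isNewformOf) (h12 : CoatesLiTianZhai2015.thm12_fullBSD_twist)
    (hGZK : rank_eq_analyticRank_of_analyticRank_le_one)
    (hXL : Summit.BirchSwinnertonDyer.BirchSwinnertonDyer.Theses.GoldfeldAllTwistsTwoConverse.RankOneTwoConverseCMSevenAdditiveTwo)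
    {l : ℕ} [Fact l.Prime] (hl4 : l % 4 = 1) (hl7 : legendreSym l (-7) = -1)
    (W : WeierstrassCurve ℚ) [W.IsElliptic] (C : VariableChange ℚ)
    (hC : C • W = cm7.quadraticTwist ((-l : ℤ) : ℚ)) :
    W.mordellWeilRank = 1 ∧ AddCommGroup.primaryComponent W.sha 2 = ⊥ := by
  obtain ⟨hr, hbot, -, -⟩ := bsdp_two_iff_shaAn_unit_primeTwist hGZK hl4 hl7 W C hC
    (analyticRank_eq_one_inertPrimeTwist_of_crux hpar hnf h12 hXL hl4 hl7 W C hC)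
  exact ⟨hr, hbot⟩

/-- `(q/7) = (−7/q)` for a prime `q ≡ 1 (mod 4)`: `(−7/q) = (−1/q)(7/q) = (7/q) = (q/7)` (first supplement and
quadratic reciprocity for `q ≡ 1 (mod 4)`). [folklore] -/
theorem jacobiSym_seven_eq_legendreSym_neg_seven {l : ℕ} [Fact l.Prime] (hl4 : l % 4 = 1) :
    jacobiSym l 7 = legendreSym l (-7) := by
  have hl2 : l ≠ 2 := by omega
  have h1 : jacobiSym (l : ℤ) 7 = jacobiSym 7 l := by
    have h := jacobiSym.quadratic_reciprocity_one_mod_four hl4 (by decide : Odd 7)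
    exact_mod_cast h
  have h2 : jacobiSym 7 l = legendreSym l 7 := (jacobiSym.legendreSym.to_jacobiSym l 7).symm
  rw [h1, h2, show (-7 : ℤ) = -1 * 7 by norm_num, legendreSym.mul, legendreSym.at_neg_one hl2,
    ZMod.χ₄_nat_one_mod_four hl4, one_mul]

/-- **The Heegner sub-leaf `X049HeegnerNonTorsionEvenDiscr` at the one field `ℚ(√−q)` (whose analytic half is
Kriz 2021 Thm. 9.10) ⟹ Conjecture D(q)**, granted 2-parity, Modularity, CLTZ 1.2 at `R = 1`, Gross–Zagier and
Heegner rationality; NO Selmer hypothesis left (§3). [cite: GrossZagier1986, Thm. I.(6.3) and I.§7]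
[cite: DokchitserDokchitserAnnals2010, Thm. 1.4] -/
theorem analyticRank_eq_one_inertPrimeTwist_of_heegnerNonTorsion
    (hpar : ∀ (W : WeierstrassCurve ℚ) [W.IsElliptic], p_parity W 2)
    (hnf : ModularForms.exists_isNewformOf) (h12 : CoatesLiTianZhai2015.thm12_fullBSD_twist)
    (hGZ : ∀ (N : ℕ) [NeZero N] (W : WeierstrassCurve ℚ) (K : Type) [Field K] [NumberField K],
      gross_zagier N W K)
    (hHP : ∀ (W : WeierstrassCurve ℚ) (K : Type) [Field K] [NumberField K], exists_isHeegnerPoint W K)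
    (hNT : X049HeegnerNonTorsionEvenDiscr)
    {l : ℕ} [Fact l.Prime] (hl4 : l % 4 = 1) (hl7 : legendreSym l (-7) = -1)
    (W : WeierstrassCurve ℚ) [W.IsElliptic] (C : VariableChange ℚ)
    (hC : C • W = cm7.quadraticTwist ((-l : ℤ) : ℚ)) : W.analyticRank = 1 := by
  have hl : l.Prime := Fact.out
  have hq7 : jacobiSym l 7 = -1 := by rw [jacobiSym_seven_eq_legendreSym_neg_seven hl4, hl7]
  exact analyticRank_eq_one_inertPrimeTwist_of_heegnerNonTorsionEvenDiscr hnf h12 hGZ hHP hNT hl hl4 hq7 W C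
    (by exact_mod_cast hC) (selmerCorank_two_eq_one_inertPrimeTwist hpar hnf h12 hl4 hl7 W C hC)

end Summit.BirchSwinnertonDyer.BirchSwinnertonDyer.Theorems.GoldfeldGoodTwists
end
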